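import Literature.MathematicalPhysics.QuantumFieldTheory.Balaban1983to89.Node00.TorusCoverCollarOfMeets
import Literature.MathematicalPhysics.QuantumFieldTheory.Balaban1983to89.Node00.CriticalOnFibreTopCore

/-!
# NODE 00 — [15] «Δ₀ ⊂ B_j(Λ_j)» FOR THE CORE PLAQUETTES ∕ BONDS OF THE TOP CLASS: the LEVEL SELECTION of the per-plaquette interface — every CORE plaquette of the
# level-`m` top class (k0-s1-w3's restriction `p ∉ Sect2.printedPlaqs s.Ω k 0`) MEETS `Ω_j` for some level `j` with `max m 1 ≤ j ≤ k`, every CORE bond (`b ∉ Sect2.bondsDeep (Ω₁)ᶜ`)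
# has its (1.2)-stencil meeting such an `Ω_j` — and the (144) collar of the datum of the grid cube of a bond whose STENCIL meets `Ω_j`

Cell `pub-ymgap`, width seat `pub-ymgap-dag-n07-w4` (director-ym №197 ∕ HUMAN RULING D-0149), node N07 = [15] = [Balaban1985Variational]; [6] = [Balaban1985RegularSpaces];
[III] = [Balaban1988Convergent]; the S3 → S6 junction of plan's `W-SEAT-START-LIST.md` § n07 (this seat's SUPPLIER RECIPE on the cell bus, step «pick the level j»).  NEW leaf,
PROOF kind (no `def`); CONSUMED BY NAME, nothing modified: this seat's `Node00.TorusCoverCollarOfMeets` (p592904), k0-s1-w3's `Node00.CriticalOnFibreTopCore` (p585451: the Core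
restriction; only the vocabulary `Sect2.printedPlaqs`, `Sect2.bondsDeep` is read), def-P11's `Sect2.printedPlaqs` ∕ `plaqNoBondIn` ∕ `omegaPlaqsTop` ∕ `omegaBondsTop`,
r12 `B15DeterminingSets.(gammaRegion_zero, pts_zero, bondsOf)`, `B8Eq17ClassAkV1.plaqsOf`.

WHY.  The per-plaquette tokens `LocalLetters167∕165TopStepCore` (p587134) ask, at a CORE plaquette `p` of the level-`m` top class, for a local gauge around `p` at the unit
`η_j` of SOME level `j`, `m ≤ j ≤ k`; the supplier's cube is the [6]-Prop.-6 datum of the grid cube of `p`'s base corner AT LEVEL `j` (`TorusCoverBoxStencils` §2,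
`TorusCoverLocalGaugeBox`, `TorusCoverCollarOfMeets`), whose collar sits in `Ω_{j−1}` as soon as `p` MEETS `Ω_j` (`j ≥ 2`; the support at `j = 1`).  Print: «a unit cube
Δ₀ ⊂ B_j(Λ_j) containing p or b» (p. 302) — the level is the one whose region the plaquette meets.  THIS FILE supplies that level for the core members: at `m ≥ 1` it is
`j = m` itself (`omegaPlaqsTop … m = plaqsOf (Ω m)`); at `m = 0` a core plaquette (NOT a pure-data one: not «touching `Ω₁ᶜ` with no bond inside `Ω₁`») has all corners in
`Ω₁` or a bond inside `Ω₁`, so it MEETS `Ω₁`: `j = 1`; a core bond has a stencil point in `Ω₁` — for bonds the collar lemma is therefore re-run with a STENCIL witness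
(within `3` of `lift b.src − 𝟙`: the stencil point `x + 2e_μ`).

CONTENTS.  §1 `Sect2.mem_plaqsOf_one_of_not_mem_printedPlaqs_zero` (core at level `0` ⇒ meets `Ω₁`), ★ `Sect2.exists_level_of_core_plaq` (`∃ j, max m 1 ≤ j ≤ k ∧ p ∈ plaqsOf (Ω j)`),
`Sect2.not_mem_bondsDeep_compl_of_mem_bondsOf` (an endpoint in `X` ⇒ the stencil meets `X`), ★ `Sect2.exists_level_of_core_bond` (`∃ j, max m 1 ≤ j ≤ k ∧ b ∉ bondsDeep (Ω j)ᶜ`).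
§2 the collar with a STENCIL witness: ★ `Sect2.cover_image_cubeIdx'_subset_of_not_mem_bondsDeep_compl` (`2 ≤ j ≤ k`, floor `11d + 3L + M + 3 ≤ M₁`),
`Sect2.cover_image_cubeIdx'_subset_hullD_of_not_mem_bondsDeep_compl` (`j = 1`).

HONEST FRAMING: set-membership bookkeeping on the torus; nothing of Bałaban asserted; no token re-declared; N07 NOT discharged; K0⁷ ∕ K1⁷ NOT closed; counts unmoved
(28∕28 · 5∕27); one finite 𝕋⁴ programme at fixed ε — R4 closes the conditional rung `BalabanLadder.UV` only: NOT continuum ∕ ℝ⁴ ∕ OS ∕ mass gap ∕ Clay.  Theorems only;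
no `def`, `instance`, `notation`, `sorry`.
-/

noncomputable section

namespace Literature.MathematicalPhysics.QuantumFieldTheory.Balaban1983to89.Node00

open B15Eq112TorusCover (cover lift cover_lift)
open B14DomainGeom (Pt Within cubeIdx cubeIdx_le lt_cubeIdx)
open B14.Eq213MaximalDomains (side cubeExt)
open B7Prop1Explicit (e e_apply)
open B15DeterminingSets (bondsOf genSet pts gammaRegion_zero pts_zero)

variable {P : Params}

/-! ## §1  Core plaquettes ∕ bonds meet `Ω_j` for some admissible level -/

section Level

/-- **A CORE PLAQUETTE OF THE LEVEL-0 CLAUSE MEETS `Ω₁`**: if `p ∉ Sect2.printedPlaqs Ω k 0` (`0 < k`) — NOT «touching `Γ₀ = Ω₁ᶜ` with no bond inside `Ω₁`» — then either all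
four corners of `p` lie in `Ω₁` or one of its bonds has both endpoints in `Ω₁`; either way `p ∈ plaqsOf (Ω 1)`. [cite: Balaban1985Variational, (7) p.278 L20–33, p.302; Balaban1988Convergent, (2.2) p.255] -/
theorem Sect2.mem_plaqsOf_one_of_not_mem_printedPlaqs_zero {Ω : ℕ → Set (Site P 0)} {k : ℕ} (hk : 0 < k) {p : Plaq P 0}
    (h : p ∉ Sect2.printedPlaqs Ω k 0) : p ∈ B8Eq17ClassAkV1.plaqsOf (Ω 1) := by
  by_contra hcon
  have hc : p.src ∉ Ω 1 ∧ p.src.shift p.μ ∉ Ω 1 ∧ p.src.shift p.ν ∉ Ω 1 ∧ (p.src.shift p.μ).shift p.ν ∉ Ω 1 := by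
    simpa only [B8Eq17ClassAkV1.plaqsOf, Set.mem_setOf_eq, not_or] using hcon
  apply h
  refine ⟨?_, ?_⟩
  · -- touching `Γ₀ = Ω₁ᶜ` (indeed every corner is off `Ω₁`)
    show p ∈ B8Eq17ClassAkV1.plaqsOf (pts 0 (B15DeterminingSets.gammaRegion Ω k 0))
    rw [gammaRegion_zero Ω hk, pts_zero]
    exact Or.inl hc.1
  · -- no bond inside `Ω₁` (no corner is in `Ω₁`)
    show p ∈ Sect2.plaqNoBondIn Ω 0
    exact ⟨fun h' => hc.1 h'.1, fun h' => hc.2.1 h'.1, fun h' => hc.2.2.1 h'.1, fun h' => hc.1 h'.1⟩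

/-- ★ **THE LEVEL OF A CORE PLAQUETTE**: a plaquette of the level-`m` top class (`p ∈ Sect2.omegaPlaqsTop Ω Ω₀ m`, `m ≤ k`, `1 ≤ k`) that is CORE (`p ∉ Sect2.printedPlaqs Ω k 0`)
meets `Ω_j` for some level `j` with `max m 1 ≤ j ≤ k` (`j = m` when `m ≥ 1`, `j = 1` when `m = 0`) — the level of print's «unit cube Δ₀ ⊂ B_j(Λ_j) containing p» at which the
per-plaquette token's gauge is supplied. [cite: Balaban1985Variational, p.302, (7) p.278; Balaban1985RegularSpaces, (1.7) p.77, p.77 (convention before (1.5))] -/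
theorem Sect2.exists_level_of_core_plaq {Ω : ℕ → Set (Site P 0)} {Ω₀ : Set (Site P 0)} {k m : ℕ} (hk : 1 ≤ k) (hm : m ≤ k) {p : Plaq P 0}
    (hp : p ∈ Sect2.omegaPlaqsTop Ω Ω₀ m) (hcore : p ∉ Sect2.printedPlaqs Ω k 0) :
    ∃ j, max m 1 ≤ j ∧ j ≤ k ∧ p ∈ B8Eq17ClassAkV1.plaqsOf (Ω j) := by
  by_cases hm0 : m = 0
  · subst hm0
    exact ⟨1, by simp, hk, Sect2.mem_plaqsOf_one_of_not_mem_printedPlaqs_zero hk hcore⟩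
  · refine ⟨m, by simp [Nat.one_le_iff_ne_zero.mpr hm0], hm, ?_⟩
    rwa [Sect2.omegaPlaqsTop_of_ne_zero Ω Ω₀ hm0, omegaPlaqs_of_ne_zero Ω hm0] at hp

/-- A bond with an ENDPOINT in `X` has its (1.2)-stencil meeting `X`: `b ∈ bondsOf X ⇒ b ∉ Sect2.bondsDeep Xᶜ`. [cite: Balaban1985RegularSpaces, (1.2) p.76, p.77 (convention before (1.5))] -/
theorem Sect2.not_mem_bondsDeep_compl_of_mem_bondsOf {X : Set (Site P 0)} {b : PBond P 0} (hb : b ∈ bondsOf X) : b ∉ Sect2.bondsDeep Xᶜ := by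
  intro h
  rcases hb with hb | hb
  · exact h.1 hb
  · exact h.2.1 hb

/-- ★ **THE LEVEL OF A CORE BOND**: a bond of the level-`m` top class (`b ∈ Sect2.omegaBondsTop Ω Ω₀ m`, `m ≤ k`, `1 ≤ k`) that is CORE (`b ∉ Sect2.bondsDeep (Ω 1)ᶜ`: its
co-divergence stencil meets `Ω₁`) has its stencil meeting `Ω_j` for some `j` with `max m 1 ≤ j ≤ k` (`j = m` via an endpoint when `m ≥ 1`, `j = 1` when `m = 0`).
[cite: Balaban1985Variational, p.302; Balaban1985RegularSpaces, (1.2) p.76, (1.9) p.77] -/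
theorem Sect2.exists_level_of_core_bond {Ω : ℕ → Set (Site P 0)} {Ω₀ : Set (Site P 0)} {k m : ℕ} (hk : 1 ≤ k) (hm : m ≤ k) {b : PBond P 0}
    (hb : b ∈ Sect2.omegaBondsTop Ω Ω₀ m) (hcore : b ∉ Sect2.bondsDeep (Ω 1)ᶜ) :
    ∃ j, max m 1 ≤ j ∧ j ≤ k ∧ b ∉ Sect2.bondsDeep (Ω j)ᶜ := by
  by_cases hm0 : m = 0
  · subst hm0
    exact ⟨1, by simp, hk, hcore⟩
  · refine ⟨m, by simp [Nat.one_le_iff_ne_zero.mpr hm0], hm, Sect2.not_mem_bondsDeep_compl_of_mem_bondsOf ?_⟩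
    rw [Sect2.omegaBondsTop_of_ne_zero Ω Ω₀ hm0, Sect2.omegaBonds] at hb
    simpa [hm0] using hb

end Level

/-! ## §2  The (144) collar for a bond whose STENCIL meets `Ω_j` -/

section Stencil

/-- The lift of a point lies in the grid cube of its index. [folklore] -/
private theorem mem_cubeExt_cubeIdx' {S : ℕ} (hS : 0 < S) (x : Pt P.d) : x ∈ cubeExt S (cubeIdx S x) 0 := fun i => by
  simp only [sub_zero, add_zero]
  exact ⟨cubeIdx_le S hS x i, by have := lt_cubeIdx S hS x i; omega⟩

/-- A stencil point of a bond gives a witness within `3` of `lift b.src − 𝟙`: if `b ∉ Sect2.bondsDeep Xᶜ` then some `y` with `π y ∈ X` and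
`Within 3 (lift b.src − 𝟙) y` (the stencil `x, x + e_μ, x ± e_ν, x + e_μ ± e_ν` sits in `[x − 𝟙, x + 2·𝟙]`, `x = lift b.src`; the point `x + 2e_μ` is at distance `3`).
[cite: Balaban1985RegularSpaces, (1.2) p.76 (bookkeeping); Balaban1987RG1, (0.1) p.251] -/
private theorem exists_within_three_of_not_mem_bondsDeep_compl {X : Set (Site P 0)} {b : PBond P 0} (hb : b ∉ Sect2.bondsDeep Xᶜ) :
    ∃ y : Pt P.d, cover P y ∈ X ∧ Within ((3 : ℕ) : ℤ) (lift P b.src - fun _ => 1) y := by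
  set x := lift P b.src with hx
  have hsrc : b.src = cover P x := by rw [hx, cover_lift]
  have htgt : b.tgt = cover P (x + e b.dir) := by rw [PBond.tgt, hsrc, cover_add_e]
  -- a uniform bound: any `y` with `x i − 1 ≤ y i ≤ x i + 2` is within `3` of `x − 𝟙`
  have near : ∀ y : Pt P.d, (∀ i, x i - 1 ≤ y i ∧ y i ≤ x i + 2) → Within ((3 : ℕ) : ℤ) (x - fun _ => 1) y := fun y hy i => by
    simp only [Pi.sub_apply, Nat.cast_ofNat]
    rw [abs_le]; constructor <;> linarith [(hy i).1, (hy i).2]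
  have b0 : ∀ i : Fin P.d, x i - 1 ≤ x i ∧ x i ≤ x i + 2 := fun i => ⟨by linarith, by linarith⟩
  have bA : ∀ μ i : Fin P.d, x i - 1 ≤ (x + e μ) i ∧ (x + e μ) i ≤ x i + 2 := fun μ i => by
    simp only [Pi.add_apply, e_apply]; split_ifs <;> constructor <;> linarith
  have bS : ∀ μ i : Fin P.d, x i - 1 ≤ (x - e μ) i ∧ (x - e μ) i ≤ x i + 2 := fun μ i => by
    simp only [Pi.sub_apply, e_apply]; split_ifs <;> constructor <;> linarith
  have bAA : ∀ μ ν i : Fin P.d, x i - 1 ≤ (x + e μ + e ν) i ∧ (x + e μ + e ν) i ≤ x i + 2 := fun μ ν i => by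
    simp only [Pi.add_apply, e_apply]; split_ifs <;> constructor <;> linarith
  have bAS : ∀ μ ν i : Fin P.d, x i - 1 ≤ (x + e μ - e ν) i ∧ (x + e μ - e ν) i ≤ x i + 2 := fun μ ν i => by
    simp only [Pi.sub_apply, Pi.add_apply, e_apply]; split_ifs <;> constructor <;> linarith
  -- negate the «deep in the complement» clause
  simp only [Sect2.bondsDeep, Set.mem_setOf_eq, Set.mem_compl_iff, not_and_or, not_forall, not_not] at hb
  rcases hb with h | h | ⟨ν, h | h | h | h⟩
  · exact ⟨x, by rwa [← hsrc], near x b0⟩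
  · exact ⟨x + e b.dir, by rwa [← htgt], near _ (bA _)⟩
  · exact ⟨x + e ν, by rw [cover_add_e, ← hsrc]; exact h, near _ (bA _)⟩
  · exact ⟨x - e ν, by rw [cover_sub_e, ← hsrc]; exact h, near _ (bS _)⟩
  · exact ⟨x + e b.dir + e ν, by rw [cover_add_e, ← htgt]; exact h, near _ (bAA _ _)⟩
  · exact ⟨x + e b.dir - e ν, by rw [cover_sub_e, ← htgt]; exact h, near _ (bAS _ _)⟩

/-- ★ **(144) FOR THE CUBE OF A BOND WHOSE STENCIL MEETS `Ω_j`, `2 ≤ j ≤ k`** (the CORE bonds of `HalvingStepTopCore` at their level): the Proposition-6 collar of the datum of the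
grid cube of `lift b.src − 𝟙` projects into `Ω_{j−1}` for a separated sequence, floor `11d + 3L + M + 3 ≤ M₁` — `TorusCoverCollarOfMeets.Sect2.cover_image_cubeIdx'_subset_of_mem_bondsOf`
with the endpoint witness replaced by a stencil witness (distance `3`: the point `x + 2e_μ` of the stencil). [cite: Balaban1985Variational, (144) p.300, p.302; Balaban1985RegularSpaces, (1.2) p.76, (1.3)–(1.4) p.77, p.98; Balaban1988Convergent, (2.13) p.256] -/
theorem Sect2.cover_image_cubeIdx'_subset_of_not_mem_bondsDeep_compl {D : ℕ → Set (Set (Site P 0))} {k M₁ : ℕ} (hM₁ : 1 ≤ M₁)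
    (s : B14.Eq218Concrete.Seq D k) (hsep : Sect2.SeqSeparated M₁ s) {j : ℕ} (hj : 2 ≤ j) (hjk : j ≤ k) {M : ℕ} (hM : 1 ≤ M)
    (hfloor : 11 * P.d + 3 * P.L + M + 3 ≤ M₁) {b : PBond P 0} (hb : b ∉ Sect2.bondsDeep (s.Ω j)ᶜ) (i : ℕ) :
    cover P '' (cubeIdx' P j (by omega) M (cubeIdx (side P.L M j) (lift P b.src - fun _ => 1))).Ω i ⊆ s.Ω (j - 1) := by
  obtain ⟨y, hy, hxy⟩ := exists_within_three_of_not_mem_bondsDeep_compl hb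
  rw [cubeIdx'_Ω, show M + 11 * P.d + P.L = M + (11 * P.d + P.L) by ring]
  exact Sect2.cover_image_tcube_subset_of_within_mem hM₁ s hsep hj hjk hM (Dw := 3) (by omega)
    (mem_cubeExt_cubeIdx' (B14.Eq213MaximalDomains.side_pos P.L_pos hM j) _) hy hxy

/-- **(144) FOR THE CUBE OF A BOND WHOSE STENCIL MEETS `Ω₁` (`j = 1`)**: the collar projects into the support `hullD P M₁ 1 (Ω 1)`, floor `(11d + 3L + M)·L + 3 ≤ M₁`.
[cite: Balaban1985Variational, (144) p.300, (1) p.277; Balaban1988Convergent, p.255; Balaban1985RegularSpaces, (1.2) p.76, p.98] -/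
theorem Sect2.cover_image_cubeIdx'_subset_hullD_of_not_mem_bondsDeep_compl {M₁ : ℕ} {Ω₁ : Set (Site P 0)} {M : ℕ} (hM : 1 ≤ M)
    (hfloor : (11 * P.d + 3 * P.L + M) * P.L + 3 ≤ M₁) {b : PBond P 0} (hb : b ∉ Sect2.bondsDeep Ω₁ᶜ) (i : ℕ) :
    cover P '' (cubeIdx' P 1 le_rfl M (cubeIdx (side P.L M 1) (lift P b.src - fun _ => 1))).Ω i ⊆ hullD P M₁ 1 Ω₁ := by
  obtain ⟨y, hy, hxy⟩ := exists_within_three_of_not_mem_bondsDeep_compl hb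
  rw [cubeIdx'_Ω, show M + 11 * P.d + P.L = M + (11 * P.d + P.L) by ring]
  exact Sect2.cover_image_tcube_subset_hullD_of_within_mem hM (Dw := 3) (by nlinarith [hfloor])
    (mem_cubeExt_cubeIdx' (B14.Eq213MaximalDomains.side_pos P.L_pos hM 1) _) hy hxy

end Stencil

end Literature.MathematicalPhysics.QuantumFieldTheory.Balaban1983to89.Node00

end
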